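import Literature.AlgebraicTopology.SingularHomology.SteenrodSquares
import Mathlib.Data.ZMod.Basic
import HarnessLib

/-!
# Change of coefficient ring in singular cohomology; reduction modulo 2

A ring homomorphism `f : R → S` induces, by composition on cochains, additive maps
`f_* : Hⁿ(X; R) → Hⁿ(X; S)` compatible with cup products (Hatcher, *Algebraic Topology* (2002),
§3.1 p. 198 "change of coefficients" and §3.2 p. 215, `(φ ⌣ ψ)` is natural in the coefficient
ring); for `ℤ → ℤ/2` the kernel of `Hⁿ(X; ℤ) → Hⁿ(X; ℤ/2)` consists of the classes divisible
by `2` (the elementary half of the Bockstein sequence, Hatcher §3.E p. 303: if `φ mod 2 = δη̄`,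
lift `η̄` to `η`; then `φ - δη = 2ψ` with `ψ` a cocycle since `ℤ`-cochains are torsion free).

For the tree's cohomology `singularCohomology R R X` (ring coefficients, as used by the cup
product and the Steenrod squares) the two sides live in different module categories
(`ModuleCat R`, `ModuleCat S`), so `f_*` is built by hand on cocycles:

* `singularCohomology.π_eq_zero_iff_exists`, `π_eq_π_iff_exists_coboundary` — a cocycle has
  zero class iff it is a coboundary (absolute version of `relSingularCohomology.π_eq_zero_iff`);
* `cocyclesRingChange f n`, **`singularCohomology.ringChange f n : Hⁿ(X; R) →+ Hⁿ(X; S)`**,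
  `ringChange_π` (`f_*[u] = [f ∘ u]`), **`ringChange_cupProduct`** (`f_*(a ⌣ b) = f_*a ⌣ f_*b`);
* **`exists_eq_two_smul_of_ringChange_eq_zero`**: for `x ∈ Hⁿ(X; ℤ)` with `x mod 2 = 0` there is
  `y` with `x = 2 • y`.

Everything is proved; no named facts.

## References

* A. Hatcher, *Algebraic Topology*, CUP 2002, §3.1 p. 198, §3.2 p. 215, §3.E p. 303. [Hatcher2002]
-/

noncomputable section

open CategoryTheory

universe u v

namespace Literature.AlgebraicTopology.SingularHomology

open singularCochainComplex

variable {R S : Type v} [CommRing R] [CommRing S]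
variable {X : Type u} [TopologicalSpace X] {p q n m : ℕ}

/-! ### Zero classes are coboundaries (absolute cohomology) -/

namespace singularCohomology

/-- **A cocycle with zero class is a coboundary**: `[z] = 0` in `Hⁿ(X; R)` iff `z = δw` for a
cochain `w` of the previous degree (Hatcher 2002, §3.1 p. 198). [cite: Hatcher2002, §3.1 p. 198] -/
lemma π_eq_zero_iff_exists (z : cocycles R R X n) :
    π R R X n z = 0 ↔
      ∃ w : (singularCochainComplex R R X).X ((ComplexShape.up ℕ).prev n),
        (singularCochainComplex R R X).d _ n w = iCocycles R R X n z := by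
  have hz : (singularCochainComplex R R X).d n ((ComplexShape.up ℕ).next n)
      (iCocycles R R X n z) = 0 := by
    change ((singularCochainComplex R R X).iCycles n ≫ _) z = 0
    rw [HomologicalComplex.iCycles_d]; rfl
  have hz' : (singularCochainComplex R R X).d n (n + 1) (iCocycles R R X n z) = 0 := by
    change ((singularCochainComplex R R X).iCycles n ≫ _) z = 0
    rw [HomologicalComplex.iCycles_d]; rfl
  have e : π R R X n z = homologyCls (iCocycles R R X n z) hz := by
    rw [homologyCls_eq_homologyπ_cyclesMk _ hz (n + 1) (by simp) hz']
    change _ = π R R X n _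
    congr 1
    apply (ModuleCat.mono_iff_injective ((singularCochainComplex R R X).iCycles n)).1 inferInstance
    exact ((singularCochainComplex R R X).i_cyclesMk _ (n + 1) (by simp) hz').symm
  rw [e]
  exact homologyCls_eq_zero_iff _ hz

/-- Two cocycles have the same class iff their difference is a coboundary. [cite: Hatcher2002, §3.1 p. 198] -/
lemma π_eq_π_iff_exists (z₁ z₂ : cocycles R R X n) :
    π R R X n z₁ = π R R X n z₂ ↔
      ∃ w : (singularCochainComplex R R X).X ((ComplexShape.up ℕ).prev n),
        (singularCochainComplex R R X).d _ n w = coFn z₁ - coFn z₂ := by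
  rw [← sub_eq_zero, ← map_sub, π_eq_zero_iff_exists, map_sub]
  rfl

/-- In positive degree: `[z₁] = [z₂]` iff `δw = z₁ - z₂` for a cochain `w : Cᵐ`. [folklore] -/
lemma π_eq_π_iff_exists_coboundary (z₁ z₂ : cocycles R R X (m + 1)) :
    π R R X (m + 1) z₁ = π R R X (m + 1) z₂ ↔
      ∃ w : SingularSimplex X m → R, coboundary m w = coFn z₁ - coFn z₂ := by
  rw [π_eq_π_iff_exists, exists_d_prev_succ_iff]

/-- In degree `0`: `[z₁] = [z₂]` iff `z₁ = z₂`. [folklore] -/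
lemma π_eq_π_iff_zero (z₁ z₂ : cocycles R R X 0) :
    π R R X 0 z₁ = π R R X 0 z₂ ↔ z₁ = z₂ := by
  rw [π_eq_π_iff_exists]
  constructor
  · rintro ⟨w, hw⟩
    rw [d_prev_zero_eq_zero] at hw
    exact coFn_injective (sub_eq_zero.1 hw.symm)
  · rintro rfl; exact ⟨0, by rw [map_zero, sub_self]; rfl⟩

end singularCohomology

/-! ### Change of coefficient ring -/

section RingChange

variable (f : R →+* S)

/-- `δ(f ∘ φ) = f ∘ δφ`: composition with a ring homomorphism commutes with the coboundary
(Hatcher 2002, §3.1 p. 198). [cite: Hatcher2002, §3.1 p. 198] -/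
lemma coboundary_comp_ringHom (φ : SingularSimplex X m → R) :
    coboundary m (f ∘ φ) = f ∘ coboundary m φ := by
  funext σ
  rw [coboundary_eq, coboundary_eq, singularCochainComplex.d_apply, Function.comp_apply,
    singularCochainComplex.d_apply, map_sum]
  refine Finset.sum_congr rfl fun i _ => ?_
  rw [smul_eq_mul, smul_eq_mul, map_mul, map_pow, map_neg, map_one]
  rfl

/-- `f ∘ (φ ⌣ ψ) = (f ∘ φ) ⌣ (f ∘ ψ)` on cochains (Hatcher 2002, §3.2). [cite: Hatcher2002, §3.2 p. 215] -/
lemma cochainCup_comp_ringHom (h : p + q = n) (φ : SingularSimplex X p → R)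
    (ψ : SingularSimplex X q → R) :
    cochainCup h (f ∘ φ) (f ∘ ψ) = f ∘ cochainCup h φ ψ := by
  funext σ
  simp only [Function.comp_apply, cochainCup_apply, map_mul]

/-- `δ(f ∘ u) = 0` for a cocycle `u`. [folklore] -/
lemma d_comp_coFn (u : cocycles R R X n) :
    (singularCochainComplex S S X).d n (n + 1) (f ∘ coFn u) = 0 := by
  change coboundary n (f ∘ coFn u) = 0
  rw [coboundary_comp_ringHom, coboundary_coFn]
  funext σ; exact map_zero f

/-- **Change of ring on cocycles**: `u ↦ f ∘ u`. [cite: Hatcher2002, §3.1 p. 198] -/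
def cocyclesRingChange (n : ℕ) (u : cocycles R R X n) : cocycles S S X n :=
  cocyclesMk (R := S) (M := S) (f ∘ coFn u) (d_comp_coFn f u)

/-- `coFn (f_* u) = f ∘ coFn u`. [folklore] -/
@[simp] lemma coFn_cocyclesRingChange (u : cocycles R R X n) :
    coFn (cocyclesRingChange f n u) = f ∘ coFn u :=
  coFn_cocyclesMk (f ∘ coFn u) (d_comp_coFn f u)

/-- `f_*` is additive on cocycles. [folklore] -/
lemma cocyclesRingChange_add (u v : cocycles R R X n) :
    cocyclesRingChange f n (u + v) = cocyclesRingChange f n u + cocyclesRingChange f n v := by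
  refine coFn_injective ?_
  rw [coFn_add, coFn_cocyclesRingChange, coFn_cocyclesRingChange, coFn_cocyclesRingChange, coFn_add]
  funext σ; exact map_add f _ _

/-- `f_*` respects cohomology classes. [cite: Hatcher2002, §3.1 p. 198] -/
lemma π_cocyclesRingChange_eq_of_π_eq {u u' : cocycles R R X n}
    (h : singularCohomology.π R R X n u = singularCohomology.π R R X n u') :
    singularCohomology.π S S X n (cocyclesRingChange f n u) =
      singularCohomology.π S S X n (cocyclesRingChange f n u') := by
  cases n with
  | zero =>
    rw [(singularCohomology.π_eq_π_iff_zero u u').1 h]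
  | succ m =>
    obtain ⟨w, hw⟩ := (singularCohomology.π_eq_π_iff_exists_coboundary u u').1 h
    refine (singularCohomology.π_eq_π_iff_exists_coboundary _ _).2 ⟨f ∘ w, ?_⟩
    rw [coboundary_comp_ringHom, hw, coFn_cocyclesRingChange, coFn_cocyclesRingChange]
    funext σ; exact map_sub f _ _

/-- `f_*` on classes (via a chosen representative). [folklore] -/
def ringChangeClass (n : ℕ) (x : singularCohomology R R X n) : singularCohomology S S X n :=
  singularCohomology.π S S X n (cocyclesRingChange f n (Classical.choose (π_surjective R n x)))

/-- `ringChangeClass f n [u] = [f ∘ u]`. [folklore] -/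
lemma ringChangeClass_π (u : cocycles R R X n) :
    ringChangeClass f n (singularCohomology.π R R X n u) =
      singularCohomology.π S S X n (cocyclesRingChange f n u) :=
  π_cocyclesRingChange_eq_of_π_eq f
    (Classical.choose_spec (π_surjective R n (singularCohomology.π R R X n u)))

/-- **Change of coefficient ring in cohomology**: the additive map
`f_* : Hⁿ(X; R) → Hⁿ(X; S)`, `[u] ↦ [f ∘ u]`, induced by a ring homomorphism `f : R → S`
(Hatcher 2002, §3.1 p. 198). [cite: Hatcher2002, §3.1 p. 198] -/
def singularCohomology.ringChange (X : Type u) [TopologicalSpace X] (n : ℕ) :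
    singularCohomology R R X n →+ singularCohomology S S X n where
  toFun := ringChangeClass f n
  map_zero' := by
    rw [← map_zero (ConcreteCategory.hom (singularCohomology.π R R X n)), ringChangeClass_π]
    have : cocyclesRingChange f n (0 : cocycles R R X n) = 0 := coFn_injective (by
      rw [coFn_cocyclesRingChange, coFn_zero, coFn_zero]; funext σ; exact map_zero f)
    rw [this, map_zero]
  map_add' x y := by
    induction x using singularCohomology_induction_on with
    | h u =>
      induction y using singularCohomology_induction_on with
      | h v =>
        rw [← map_add, ringChangeClass_π, ringChangeClass_π, ringChangeClass_π,
          cocyclesRingChange_add, map_add]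

/-- `f_*[u] = [f ∘ u]`. [cite: Hatcher2002, §3.1 p. 198] -/
@[simp] lemma singularCohomology.ringChange_π (u : cocycles R R X n) :
    singularCohomology.ringChange f X n (singularCohomology.π R R X n u) =
      singularCohomology.π S S X n (cocyclesRingChange f n u) :=
  ringChangeClass_π f u

/-- **`f_*` is multiplicative**: `f_*(a ⌣ b) = f_*a ⌣ f_*b` (Hatcher 2002, §3.2: the cup product
is natural in the coefficient ring). [cite: Hatcher2002, §3.2 p. 215] -/
theorem singularCohomology.ringChange_cupProduct (h : p + q = n) (a : singularCohomology R R X p)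
    (b : singularCohomology R R X q) :
    singularCohomology.ringChange f X n (cupProduct h a b) =
      cupProduct h (singularCohomology.ringChange f X p a) (singularCohomology.ringChange f X q b) := by
  induction a using singularCohomology_induction_on with
  | h u =>
    induction b using singularCohomology_induction_on with
    | h v =>
      rw [cupProduct_π_π, singularCohomology.ringChange_π, singularCohomology.ringChange_π,
        singularCohomology.ringChange_π, cupProduct_π_π]
      congr 1
      refine coFn_injective ?_
      rw [coFn_cocyclesRingChange, coFn_eq, iCocycles_cocyclesCup, coFn_eq, iCocycles_cocyclesCup,
        ← coFn_eq, ← coFn_eq, ← coFn_eq, ← coFn_eq, coFn_cocyclesRingChange,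
        coFn_cocyclesRingChange, cochainCup_comp_ringHom]

end RingChange

/-! ### Reduction modulo `2`: the kernel is `2 Hⁿ(X; ℤ)` -/

section ModTwo

/-- `δ(φ - ψ) = δφ - δψ`. [folklore] -/
lemma coboundary_sub (φ ψ : SingularSimplex X m → R) :
    coboundary m (φ - ψ) = coboundary m φ - coboundary m ψ :=
  ((singularCochainComplex R R X).d m (m + 1)).hom.map_sub φ ψ

/-- An integral cochain vanishing modulo `2` is twice an integral cochain. [folklore] -/
lemma exists_eq_add_self_of_comp_eq_zero (φ : SingularSimplex X n → ℤ)
    (h : (Int.castRingHom (ZMod 2)) ∘ φ = 0) :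
    ∃ ψ : SingularSimplex X n → ℤ, φ = ψ + ψ := by
  refine ⟨fun σ => φ σ / 2, funext fun σ => ?_⟩
  have h2 : (2 : ℤ) ∣ φ σ := by
    have := congrFun h σ
    exact (ZMod.intCast_zmod_eq_zero_iff_dvd (φ σ) 2).1 this
  change φ σ = φ σ / 2 + φ σ / 2
  rw [← two_mul, Int.mul_ediv_cancel' h2]

/-- Half of an integral cocycle divisible by `2` is a cocycle (integral cochains are torsion
free). [folklore] -/
lemma coboundary_eq_zero_of_add_self {ψ : SingularSimplex X n → ℤ}
    (h : coboundary n (ψ + ψ) = 0) : coboundary n ψ = 0 := by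
  rw [coboundary_add] at h
  funext σ
  have := congrFun h σ
  exact add_self_eq_zero.1 this

/-- **The kernel of reduction modulo `2` is `2 Hⁿ(X; ℤ)`**: if `x ∈ Hⁿ(X; ℤ)` maps to `0` in
`Hⁿ(X; ℤ/2)` then `x = y + y` for some `y` (Hatcher 2002, §3.E p. 303, exactness of the Bockstein
sequence `Hⁿ(X; ℤ) →² Hⁿ(X; ℤ) → Hⁿ(X; ℤ/2)` at the middle term; elementary proof: `x = [φ]`,
`φ mod 2 = δη̄`, lift `η̄` to `η`, then `φ - δη = 2ψ` with `δψ = 0`). [cite: Hatcher2002, §3.E p. 303] -/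
theorem exists_eq_add_self_of_ringChange_eq_zero (x : singularCohomology ℤ ℤ X n)
    (hx : singularCohomology.ringChange (Int.castRingHom (ZMod 2)) X n x = 0) :
    ∃ y : singularCohomology ℤ ℤ X n, x = y + y := by
  induction x using singularCohomology_induction_on with
  | h u =>
    rw [singularCohomology.ringChange_π, ← map_zero (ConcreteCategory.hom
      (singularCohomology.π (ZMod 2) (ZMod 2) X n))] at hx
    cases n with
    | zero =>
      have h0 := (singularCohomology.π_eq_π_iff_zero _ _).1 hx
      have hc : (Int.castRingHom (ZMod 2)) ∘ coFn u = 0 := by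
        rw [← coFn_cocyclesRingChange, h0, coFn_zero]
      obtain ⟨ψ, hψ⟩ := exists_eq_add_self_of_comp_eq_zero (coFn u) hc
      have hdψ : coboundary 0 ψ = 0 :=
        coboundary_eq_zero_of_add_self (by rw [← hψ, coboundary_coFn])
      have hdψ' : (singularCochainComplex ℤ ℤ X).d 0 (0 + 1) ψ = 0 := hdψ
      refine ⟨singularCohomology.π ℤ ℤ X 0 (cocyclesMk ψ hdψ'), ?_⟩
      rw [← map_add]
      congr 1
      exact coFn_injective (by rw [hψ, coFn_add, coFn_cocyclesMk])
    | succ m =>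
      obtain ⟨wbar, hw⟩ := (singularCohomology.π_eq_π_iff_exists_coboundary _ _).1 hx
      rw [coFn_zero, sub_zero, coFn_cocyclesRingChange] at hw
      -- lift `wbar` to an integral cochain
      let w : SingularSimplex X m → ℤ := fun σ => ((wbar σ).val : ℤ)
      have hwlift : (Int.castRingHom (ZMod 2)) ∘ w = wbar := by
        funext σ
        change (((wbar σ).val : ℤ) : ZMod 2) = wbar σ
        rw [Int.cast_natCast, ZMod.natCast_zmod_val]
      -- `φ = u - δw` vanishes mod 2
      have hφ : (Int.castRingHom (ZMod 2)) ∘ (coFn u - coboundary m w) = 0 := by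
        have e : (Int.castRingHom (ZMod 2)) ∘ (coFn u - coboundary m w) =
            (Int.castRingHom (ZMod 2)) ∘ coFn u - (Int.castRingHom (ZMod 2)) ∘ coboundary m w := by
          funext σ; exact map_sub _ _ _
        rw [e, ← coboundary_comp_ringHom, hwlift, hw, sub_self]
      obtain ⟨ψ, hψ⟩ := exists_eq_add_self_of_comp_eq_zero _ hφ
      have hdψ : coboundary (m + 1) ψ = 0 := coboundary_eq_zero_of_add_self (by
        rw [← hψ, coboundary_sub, coboundary_coFn, coboundary_coboundary, sub_zero])
      have hdψ' : (singularCochainComplex ℤ ℤ X).d (m + 1) (m + 1 + 1) ψ = 0 := hdψ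
      refine ⟨singularCohomology.π ℤ ℤ X (m + 1) (cocyclesMk ψ hdψ'), ?_⟩
      rw [← map_add]
      refine (singularCohomology.π_eq_π_iff_exists_coboundary _ _).2 ⟨w, ?_⟩
      rw [coFn_add, coFn_cocyclesMk, ← hψ, sub_sub_cancel]

end ModTwo

end Literature.AlgebraicTopology.SingularHomology
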